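import Literature.Geometry.Symplectic.SurfaceTubularCharts
import HarnessLib

/-!
# The round tubes of a symplectic surface: finite tubular atlas, compactness, connectedness

Topic `Literature/Geometry/Symplectic`; layer C2d of the construction of the symplectic tubular
neighbourhood with its `U(1)`-structure of a closed symplectic surface `b : S → N` in a
symplectic `4`-manifold (McLean, GAFA 2012, **Lemma 5.14**, `k = 1`), for the fact seat of
`Literature.Geometry.Symplectic.mclean_divisorComplement_convex_four`.

With the box charts of `SurfaceTubularCharts.lean` (`D : Setup N S V`, `S` compact Hausdorff):

* a finite tubular atlas (`Atlas`, `atlas`), the embedded tube domain `N₃ = ⋃ᵢ Oᵢ ⊇ b(S)`, the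
  uniform fibre radius `ρ0` and the **fibre closure properties** `exists_mem_N₃_Θ_eq_of_le`,
  `exists_mem_N₃_Θ_eq` (every normal vector of length `< ρ0`, and every normal vector not
  longer than that of a point of `N₃`, is the normal coordinate of a unique point of `N₃`);
* the squared radius `ρ2 x = K (π₁ x) ‖nrm x‖²` (the moment-map-to-be), `ρ2 = 0 ↔ x ∈ b(S)`
  on `N₂`, the round tubes `T ε = {ρ2 < ε}`, `Tbar ε = {ρ2 ≤ ε}` (inside `N₃`) and the model
  sets `Sbar ε = {(y, w) : w ∈ F y, K y ‖w‖² ≤ ε}` with the continuous inverse `Λ` of `Θ` on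
  them (`continuousOn_Λ`): for `ε < εc` the closed tube `Tbar ε = Λ '' Sbar ε` is **compact**
  (`isCompact_Tbar`), the closed tubes shrink to the surface (`exists_Tbar_subset`), and the
  punctured tube `T ε ∖ b(S)` is **preconnected** when `S` is connected
  (`isPreconnected_T_diff_range`: punctured-disc bundle over a connected base).

Everything here is proved; no named facts (D-0026).

## References

* M. McLean, *The growth rate of symplectic homology and affine varieties*, GAFA 22 (2012),
  Lemma 5.14, pp. 35–37 (arXiv:1011.2542). [Mclean2012]
* M. W. Hirsch, *Differential Topology* (1976), Ch. 4 §5, Thms. 5.1–5.2. [HirschDT1976]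
-/

noncomputable section

open scoped Manifold ContDiff Topology RealInnerProductSpace
open Set Function Module Filter Metric
open Literature.Topology.FourManifolds
open Literature.Geometry.Kaehler
open Literature.Geometry.Manifold

namespace Literature.Geometry.Symplectic

namespace SurfaceTube

/-- Local notation for the model plane. -/
local notation "E2" => EuclideanSpace ℝ (Fin 2)

variable {N : Type*} [TopologicalSpace N] [ChartedSpace (EuclideanSpace ℝ (Fin 4)) N]
  [IsManifold (𝓡 4) ∞ N] {S : Type*} [TopologicalSpace S] [ChartedSpace (EuclideanSpace ℝ (Fin 2)) S]
  [IsManifold (𝓡 2) ∞ S] {V : Type*} [NormedAddCommGroup V] [InnerProductSpace ℝ V]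
  [FiniteDimensional ℝ V] (D : Setup N S V)

namespace Setup

variable [CompactSpace S] [Nonempty S] [T2Space S]

/-! ### A finite tubular atlas -/

/-- **A finite tubular atlas**: finitely many box charts whose base balls cover the surface.
[folklore] -/
structure Atlas where
  /-- number of charts -/
  k : ℕ
  hk : 0 < k
  /-- centres -/
  yc : Fin k → S
  /-- the box charts -/
  chart : ∀ i, D.BoxChart (yc i)
  cover : ∀ y : S, ∃ i, y ∈ (extChartAt (𝓡 2) (yc i)).source ∧
    extChartAt (𝓡 2) (yc i) y ∈ ball (extChartAt (𝓡 2) (yc i) (yc i)) (chart i).δ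

/-- The base patch of a box chart: the points of the chart domain of `y₀` over the base ball.
[folklore] -/
def basePatch {y₀ : S} (B : D.BoxChart y₀) : Set S :=
  (extChartAt (𝓡 2) y₀).source ∩ extChartAt (𝓡 2) y₀ ⁻¹' ball (extChartAt (𝓡 2) y₀ y₀) B.δ

/-- Base patches are open. [folklore] -/
theorem isOpen_basePatch {y₀ : S} (B : D.BoxChart y₀) : IsOpen (D.basePatch B) :=
  (continuousOn_extChartAt y₀).isOpen_inter_preimage (isOpen_extChartAt_source y₀) isOpen_ball

/-- The centre lies in its base patch. [folklore] -/
theorem mem_basePatch {y₀ : S} (B : D.BoxChart y₀) : y₀ ∈ D.basePatch B :=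
  ⟨mem_extChartAt_source y₀, mem_ball_self B.hδ⟩

/-- **Existence of a finite tubular atlas** (compactness of `S`). [folklore] -/
theorem nonempty_atlas : Nonempty D.Atlas := by
  have B : ∀ y : S, D.BoxChart y := fun y ↦ Classical.choice (D.nonempty_boxChart y)
  obtain ⟨t, ht⟩ := isCompact_univ.elim_finite_subcover (fun y ↦ D.basePatch (B y))
    (fun y ↦ D.isOpen_basePatch (B y)) fun y _ ↦ mem_iUnion.2 ⟨y, D.mem_basePatch (B y)⟩
  have htne : t.Nonempty := by
    obtain ⟨y⟩ := ‹Nonempty S›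
    obtain ⟨y', hy', -⟩ := mem_iUnion₂.1 (ht (mem_univ y))
    exact ⟨y', hy'⟩
  set k := t.card with hk
  have hkpos : 0 < k := Finset.card_pos.2 htne
  let e : Fin k ≃ {y // y ∈ t} := (Finset.equivFin t).symm
  refine ⟨{
    k := k
    hk := hkpos
    yc := fun i ↦ (e i).1
    chart := fun i ↦ B (e i).1
    cover := fun y ↦ ?_ }⟩
  obtain ⟨y', hy', hy⟩ := mem_iUnion₂.1 (ht (mem_univ y))
  refine ⟨e.symm ⟨y', hy'⟩, ?_⟩
  exact (show ∀ z : {y // y ∈ t}, z = ⟨y', hy'⟩ → y ∈ D.basePatch (B z.1) from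
    fun z hz ↦ hz ▸ hy) _ (e.apply_symm_apply _)

/-- A fixed finite tubular atlas. [folklore] -/
def atlas : D.Atlas := Classical.choice D.nonempty_atlas

/-- The index type of the atlas is nonempty. [folklore] -/
instance : Nonempty (Fin D.atlas.k) := ⟨⟨0, D.atlas.hk⟩⟩

/-! ### The embedded tube domain `N₃` and the fibre closure properties -/

/-- **The embedded tube domain** `N₃ = ⋃ᵢ Oᵢ`. [folklore] -/
def N₃ : Set N := ⋃ i, (D.atlas.chart i).O

/-- `N₃` is open. [folklore] -/
theorem isOpen_N₃ : IsOpen D.N₃ := isOpen_iUnion fun i ↦ (D.atlas.chart i).isOpen_O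

/-- `N₃ ⊆ N₂`. [folklore] -/
theorem N₃_subset_N₂ : D.N₃ ⊆ D.N₂ := iUnion_subset fun i ↦ (D.atlas.chart i).O_subset_N₂

/-- `N₃ ⊆ N₁`. [folklore] -/
theorem N₃_subset_N₁ : D.N₃ ⊆ D.N₁ := D.N₃_subset_N₂.trans D.N₂_subset_N₁

/-- Membership in `N₃`. [folklore] -/
theorem mem_N₃_iff {x : N} : x ∈ D.N₃ ↔ ∃ i, x ∈ (D.atlas.chart i).O := mem_iUnion

/-- **Realisation over a base patch**: a normal vector of length `< ρᵢ` over the base patch of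
chart `i` is the normal coordinate of a point of `Oᵢ ⊆ N₃`. [folklore] -/
theorem exists_mem_O_Θ_eq (i : Fin D.atlas.k) {y : S} (hy : y ∈ D.basePatch (D.atlas.chart i))
    {w : V} (hw : w ∈ D.F y) (hwρ : ‖w‖ < (D.atlas.chart i).ρ) :
    ∃ x ∈ (D.atlas.chart i).O, D.Θ x = (y, w) :=
  (D.atlas.chart i).exists_mem_O_Θ_eq hy.1 hy.2 hw hwρ

/-- The surface lies in `N₃`. [folklore] -/
theorem b_mem_N₃ (y : S) : D.b y ∈ D.N₃ := by
  obtain ⟨i, hi⟩ := D.atlas.cover y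
  obtain ⟨x, hx, hxeq⟩ := D.exists_mem_O_Θ_eq i hi (Submodule.zero_mem _) (by simpa using (D.atlas.chart i).hρ)
  have hxb : x = D.b y :=
    D.injOn_Θ ((D.atlas.chart i).O_subset_N₂ hx) (D.b_mem_N₂ y) (hxeq.trans (D.Θ_b y).symm)
  exact D.mem_N₃_iff.2 ⟨i, hxb ▸ hx⟩

/-- The surface lies in `N₃`. [folklore] -/
theorem range_b_subset_N₃ : range D.b ⊆ D.N₃ := by
  rintro _ ⟨y, rfl⟩; exact D.b_mem_N₃ y

/-- **Fibre closure property**: over the foot of a point `x ∈ N₃`, every normal vector not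
longer than `nrm x` is the normal coordinate of a point of `N₃` (the tube is a union of round
discs). [folklore] -/
theorem exists_mem_N₃_Θ_eq_of_le {x : N} (hx : x ∈ D.N₃) {w : V} (hw : w ∈ D.F (D.π₁ x))
    (hle : ‖w‖ ≤ ‖D.nrm x‖) : ∃ x' ∈ D.N₃, D.Θ x' = (D.π₁ x, w) := by
  obtain ⟨i, hi⟩ := D.mem_N₃_iff.1 hx
  set B := D.atlas.chart i
  have hbox := B.Ξ_mem_box hi
  have hy : D.π₁ x ∈ D.basePatch B :=
    ⟨D.π₁_mem_source_of_mem_Ξdom (B.O_subset hi), hbox.1⟩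
  obtain ⟨x', hx', heq⟩ := D.exists_mem_O_Θ_eq i hy hw (hle.trans_lt (B.norm_nrm_lt hi))
  exact ⟨x', D.mem_N₃_iff.2 ⟨i, hx'⟩, heq⟩

/-- **The uniform fibre radius** `ρ0 = minᵢ ρᵢ > 0`. [folklore] -/
def ρ0 : ℝ := Finset.univ.inf' Finset.univ_nonempty fun i ↦ (D.atlas.chart i).ρ

/-- `ρ0 ≤ ρᵢ`. [folklore] -/
theorem ρ0_le (i : Fin D.atlas.k) : D.ρ0 ≤ (D.atlas.chart i).ρ :=
  Finset.inf'_le _ (Finset.mem_univ i)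

/-- `ρ0 > 0`. [folklore] -/
theorem ρ0_pos : 0 < D.ρ0 := by
  obtain ⟨i, -, hi⟩ := Finset.exists_mem_eq_inf' Finset.univ_nonempty fun i ↦ (D.atlas.chart i).ρ
  rw [ρ0, hi]
  exact (D.atlas.chart i).hρ

/-- **Uniform realisation**: every normal vector of length `< ρ0` is the normal coordinate of a
point of `N₃`. [folklore] -/
theorem exists_mem_N₃_Θ_eq {y : S} {w : V} (hw : w ∈ D.F y) (hwρ : ‖w‖ < D.ρ0) :
    ∃ x ∈ D.N₃, D.Θ x = (y, w) := by
  obtain ⟨i, hi⟩ := D.atlas.cover y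
  obtain ⟨x, hx, heq⟩ := D.exists_mem_O_Θ_eq i hi hw (hwρ.trans_le (D.ρ0_le i))
  exact ⟨x, D.mem_N₃_iff.2 ⟨i, hx⟩, heq⟩

/-! ### The squared radius `ρ2 = K (π₁) ‖nrm‖²` -/

/-- **The squared radius** `ρ2 x = K (π₁ x) ‖nrm x‖²` (the moment map of the model circle
action up to the factor `-1/2`). [cite: Mclean2012, Lemma 5.14] -/
def ρ2 (x : N) : ℝ := D.K (D.π₁ x) * ‖D.nrm x‖ ^ 2

omit [T2Space S] in
/-- Unfolding of `ρ2`. [folklore] -/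
theorem ρ2_apply (x : N) : D.ρ2 x = D.K (D.π₁ x) * ‖D.nrm x‖ ^ 2 := rfl

omit [T2Space S] in
/-- `ρ2 ≥ 0`. [folklore] -/
theorem ρ2_nonneg (x : N) : 0 ≤ D.ρ2 x := mul_nonneg (D.K_pos _).le (sq_nonneg _)

omit [T2Space S] in
/-- `ρ2 = 0` on the surface. [folklore] -/
theorem ρ2_b (y : S) : D.ρ2 (D.b y) = 0 := by
  rw [ρ2, D.nrm_b, norm_zero, zero_pow two_ne_zero, mul_zero]

omit [T2Space S] in
/-- In terms of `Θ`: `ρ2 x = K (Θ x).1 ‖(Θ x).2‖²`. [folklore] -/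
theorem ρ2_eq_of_Θ_eq {x : N} {p : S × V} (h : D.Θ x = p) : D.ρ2 x = D.K p.1 * ‖p.2‖ ^ 2 := by
  rw [← h]; rfl

omit [T2Space S] in
/-- `ρ2` is smooth on `N₁`. [folklore] -/
theorem contMDiffOn_ρ2 : ContMDiffOn (𝓡 4) 𝓘(ℝ, ℝ) ∞ D.ρ2 D.N₁ :=
  (D.contMDiff_K.comp_contMDiffOn D.contMDiffOn_π₁).smul
    ((contDiff_norm_sq ℝ (n := ∞)).contMDiff.comp_contMDiffOn D.contMDiffOn_nrm)

omit [T2Space S] in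
/-- `ρ2` is continuous on `N₁`. [folklore] -/
theorem continuousOn_ρ2 : ContinuousOn D.ρ2 D.N₁ := D.contMDiffOn_ρ2.continuousOn

omit [T2Space S] in
/-- `ρ2` is continuous at the points of `N₁`. [folklore] -/
theorem continuousAt_ρ2 {x : N} (hx : x ∈ D.N₁) : ContinuousAt D.ρ2 x :=
  D.continuousOn_ρ2.continuousAt (D.isOpen_N₁.mem_nhds hx)

/-- **`ρ2 = 0` exactly on the surface** (on the embedded tube domain `N₂`). [folklore] -/
theorem ρ2_eq_zero_iff {x : N} (hx : x ∈ D.N₂) : D.ρ2 x = 0 ↔ x ∈ range D.b := by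
  constructor
  · intro h
    have hn : D.nrm x = 0 := by
      have h' : ‖D.nrm x‖ ^ 2 = 0 := by
        rcases mul_eq_zero.1 h with h1 | h1
        · exact absurd h1 (D.K_pos _).ne'
        · exact h1
      exact norm_eq_zero.1 (pow_eq_zero_iff two_ne_zero |>.1 h')
    have hΘ : D.Θ x = D.Θ (D.b (D.π₁ x)) := by
      rw [D.Θ_b, D.Θ_apply, hn]
    exact ⟨D.π₁ x, (D.injOn_Θ hx (D.b_mem_N₂ _) hΘ).symm⟩
  · rintro ⟨y, rfl⟩
    exact D.ρ2_b y

/-- `ρ2 > 0` off the surface (on `N₂`). [folklore] -/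
theorem ρ2_pos_iff {x : N} (hx : x ∈ D.N₂) : 0 < D.ρ2 x ↔ x ∉ range D.b := by
  rw [← not_iff_not, not_lt, not_not, ← D.ρ2_eq_zero_iff hx]
  exact ⟨fun h ↦ le_antisymm h (D.ρ2_nonneg x), fun h ↦ h.le⟩

omit [T2Space S] in
/-- **The minimum of the area factor** `Kmin = min_S K > 0` (compactness). [folklore] -/
theorem exists_Kmin : ∃ K₀ : ℝ, 0 < K₀ ∧ ∀ y : S, K₀ ≤ D.K y := by
  obtain ⟨y₀, -, hy₀⟩ := isCompact_univ.exists_isMinOn univ_nonempty D.continuous_K.continuousOn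
  exact ⟨D.K y₀, D.K_pos y₀, fun y ↦ hy₀ (mem_univ y)⟩

/-- The minimum of the area factor. [folklore] -/
def Kmin : ℝ := D.exists_Kmin.choose

omit [T2Space S] in
/-- `Kmin > 0`. [folklore] -/
theorem Kmin_pos : 0 < D.Kmin := D.exists_Kmin.choose_spec.1

omit [T2Space S] in
/-- `Kmin ≤ K y`. [folklore] -/
theorem Kmin_le (y : S) : D.Kmin ≤ D.K y := D.exists_Kmin.choose_spec.2 y

/-- **The critical level** `εc = Kmin ρ0²`: below it the round tubes are embedded disc bundles.
[folklore] -/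
def εc : ℝ := D.Kmin * D.ρ0 ^ 2

/-- `εc > 0`. [folklore] -/
theorem εc_pos : 0 < D.εc := mul_pos D.Kmin_pos (pow_pos D.ρ0_pos 2)

/-- Below the critical level the normal vectors are shorter than `ρ0`. [folklore] -/
theorem norm_lt_ρ0_of_lt_εc {y : S} {w : V} (h : D.K y * ‖w‖ ^ 2 < D.εc) : ‖w‖ < D.ρ0 := by
  have h1 : D.Kmin * ‖w‖ ^ 2 ≤ D.K y * ‖w‖ ^ 2 :=
    mul_le_mul_of_nonneg_right (D.Kmin_le y) (sq_nonneg _)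
  have h2 : ‖w‖ ^ 2 < D.ρ0 ^ 2 := lt_of_mul_lt_mul_left (h1.trans_lt h) D.Kmin_pos.le
  exact (sq_lt_sq₀ (norm_nonneg _) D.ρ0_pos.le).1 h2

omit [T2Space S] in
/-- A bound on the norm below a level. [folklore] -/
theorem norm_le_of_le {y : S} {w : V} {ε : ℝ} (h : D.K y * ‖w‖ ^ 2 ≤ ε) :
    ‖w‖ ≤ Real.sqrt (ε / D.Kmin) := by
  have h1 : D.Kmin * ‖w‖ ^ 2 ≤ ε := (mul_le_mul_of_nonneg_right (D.Kmin_le y) (sq_nonneg _)).trans h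
  have h2 : ‖w‖ ^ 2 ≤ ε / D.Kmin := by
    rw [le_div_iff₀ D.Kmin_pos]; linarith
  exact Real.le_sqrt_of_sq_le h2

/-! ### The model sets and the continuous inverse of `Θ` -/

/-- **The closed model disc bundle** `Sbar ε = {(y, w) : w ∈ F y, K y ‖w‖² ≤ ε}`. [folklore] -/
def Sbar (ε : ℝ) : Set (S × V) := {p | p.2 ∈ D.F p.1 ∧ D.K p.1 * ‖p.2‖ ^ 2 ≤ ε}

/-- **The punctured open model disc bundle** `Sstar ε = {(y, w) : w ∈ F y, 0 < K y ‖w‖² < ε}`.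
[folklore] -/
def Sstar (ε : ℝ) : Set (S × V) := {p | p.2 ∈ D.F p.1 ∧ 0 < D.K p.1 * ‖p.2‖ ^ 2 ∧ D.K p.1 * ‖p.2‖ ^ 2 < ε}

omit [CompactSpace S] [Nonempty S] [T2Space S] in
/-- Membership in `Sbar`. [folklore] -/
theorem mem_Sbar_iff {ε : ℝ} {p : S × V} : p ∈ D.Sbar ε ↔ p.2 ∈ D.F p.1 ∧ D.K p.1 * ‖p.2‖ ^ 2 ≤ ε :=
  Iff.rfl

omit [CompactSpace S] [Nonempty S] [T2Space S] in
/-- Membership in `Sstar`. [folklore] -/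
theorem mem_Sstar_iff {ε : ℝ} {p : S × V} :
    p ∈ D.Sstar ε ↔ p.2 ∈ D.F p.1 ∧ 0 < D.K p.1 * ‖p.2‖ ^ 2 ∧ D.K p.1 * ‖p.2‖ ^ 2 < ε :=
  Iff.rfl

omit [CompactSpace S] [Nonempty S] [T2Space S] in
/-- `Sstar ⊆ Sbar`. [folklore] -/
theorem Sstar_subset_Sbar (ε : ℝ) : D.Sstar ε ⊆ D.Sbar ε := fun _ hp ↦ ⟨hp.1, hp.2.2.le⟩

omit [CompactSpace S] [Nonempty S] [T2Space S] in
/-- The level function `(y, w) ↦ K y ‖w‖²` is continuous. [folklore] -/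
theorem continuous_level : Continuous fun p : S × V ↦ D.K p.1 * ‖p.2‖ ^ 2 :=
  (D.continuous_K.comp continuous_fst).mul ((continuous_norm.comp continuous_snd).pow 2)

omit [CompactSpace S] [Nonempty S] [T2Space S] in
/-- The model bundle condition `w ∈ F y` is closed. [folklore] -/
theorem isClosed_setOf_mem_F : IsClosed {p : S × V | p.2 ∈ D.F p.1} := by
  have h : {p : S × V | p.2 ∈ D.F p.1} = {p | D.Q p.1 p.2 = p.2} := by
    ext p; exact (D.Q_apply_eq_self_iff).symm
  rw [h]
  exact isClosed_eq ((D.continuous_Q.comp continuous_fst).clm_apply continuous_snd) continuous_snd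

omit [CompactSpace S] [Nonempty S] [T2Space S] in
/-- `Sbar ε` is closed. [folklore] -/
theorem isClosed_Sbar (ε : ℝ) : IsClosed (D.Sbar ε) :=
  D.isClosed_setOf_mem_F.inter (isClosed_le D.continuous_level continuous_const)

omit [T2Space S] in
/-- **`Sbar ε` is compact** (`S` compact, fibres bounded closed discs). [folklore] -/
theorem isCompact_Sbar (ε : ℝ) : IsCompact (D.Sbar ε) := by
  refine (isCompact_univ.prod (isCompact_closedBall (0 : V) (Real.sqrt (ε / D.Kmin)))).of_isClosed_subset
    (D.isClosed_Sbar ε) fun p hp ↦ ⟨mem_univ _, ?_⟩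
  rw [mem_closedBall, dist_zero_right]
  exact D.norm_le_of_le hp.2

/-- Below the critical level the model disc bundle is realised inside `N₃`. [folklore] -/
theorem Sbar_subset_image {ε : ℝ} (hε : ε < D.εc) : D.Sbar ε ⊆ D.Θ '' D.N₃ := by
  rintro ⟨y, w⟩ ⟨hw, hle⟩
  obtain ⟨x, hx, heq⟩ := D.exists_mem_N₃_Θ_eq hw (D.norm_lt_ρ0_of_lt_εc (hle.trans_lt hε))
  exact ⟨x, hx, heq⟩

/-- **The inverse `Λ` of `Θ` on the embedded tube domain** (an arbitrary right inverse,
meaningful on `Θ '' N₃`). [folklore] -/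
def Λ (p : S × V) : N :=
  haveI := Classical.propDecidable (p ∈ D.Θ '' D.N₃)
  if h : p ∈ D.Θ '' D.N₃ then h.choose else D.b (Classical.arbitrary S)

/-- `Λ p ∈ N₃` and `Θ (Λ p) = p` on the image. [folklore] -/
theorem Λ_spec {p : S × V} (hp : p ∈ D.Θ '' D.N₃) : D.Λ p ∈ D.N₃ ∧ D.Θ (D.Λ p) = p := by
  rw [Λ, dif_pos hp]
  exact hp.choose_spec

/-- `Λ ∘ Θ = id` on `N₃`. [folklore] -/
theorem Λ_Θ {x : N} (hx : x ∈ D.N₃) : D.Λ (D.Θ x) = x := by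
  have h := D.Λ_spec ⟨x, hx, rfl⟩
  exact D.injOn_Θ (D.N₃_subset_N₂ h.1) (D.N₃_subset_N₂ hx) h.2

/-- **Chart formula for `Λ`**: over the base patch of chart `i` and for short normal vectors,
`Λ (y, w) = invᵢ (φᵢ y, ζᵢ y w)`. [folklore] -/
theorem Λ_eq_inv (i : Fin D.atlas.k) {y : S} (hy : y ∈ D.basePatch (D.atlas.chart i)) {w : V}
    (hw : w ∈ D.F y) (hwρ : ‖w‖ < (D.atlas.chart i).ρ) :
    D.Λ (y, w) = (D.atlas.chart i).inv
      (extChartAt (𝓡 2) (D.atlas.yc i) y, D.ζ (D.atlas.chart i).c y w) := by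
  set B := D.atlas.chart i
  have hy' : (extChartAt (𝓡 2) (D.atlas.yc i)).symm (extChartAt (𝓡 2) (D.atlas.yc i) y) = y :=
    (extChartAt (𝓡 2) (D.atlas.yc i)).left_inv hy.1
  have hne : D.Q y B.c ≠ 0 := by
    have h := B.Q_symm_ne_zero hy.2
    rwa [hy'] at h
  have hpbox : (extChartAt (𝓡 2) (D.atlas.yc i) y, D.ζ B.c y w) ∈ B.box :=
    ⟨hy.2, by rw [mem_ball_zero_iff, D.norm_ζ hne hw]; exact hwρ⟩
  have hΘ : D.Θ (B.inv (extChartAt (𝓡 2) (D.atlas.yc i) y, D.ζ B.c y w)) = (y, w) := by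
    rw [B.Θ_inv hpbox]
    show ((extChartAt (𝓡 2) (D.atlas.yc i)).symm (extChartAt (𝓡 2) (D.atlas.yc i) y),
      D.Fr B.c ((extChartAt (𝓡 2) (D.atlas.yc i)).symm (extChartAt (𝓡 2) (D.atlas.yc i) y))
        (D.ζ B.c y w)) = (y, w)
    rw [hy', D.Fr_ζ hne hw]
  have hmem : B.inv (extChartAt (𝓡 2) (D.atlas.yc i) y, D.ζ B.c y w) ∈ D.N₃ :=
    D.mem_N₃_iff.2 ⟨i, B.inv_mem_O hpbox⟩
  rw [← hΘ, D.Λ_Θ hmem]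

/-- **`Λ` is continuous on the model disc bundles below the critical level.** [folklore] -/
theorem continuousOn_Λ {ε : ℝ} (hε : ε < D.εc) : ContinuousOn D.Λ (D.Sbar ε) := by
  rintro ⟨y, w⟩ hp
  obtain ⟨i, hi⟩ := D.atlas.cover y
  set B := D.atlas.chart i
  -- the relatively open piece over the base patch with short normal vectors
  set P : Set (S × V) := {p | p.1 ∈ D.basePatch B ∧ ‖p.2‖ < B.ρ} with hP
  have hPopen : IsOpen P :=
    ((D.isOpen_basePatch B).preimage continuous_fst).inter
      (isOpen_lt (continuous_norm.comp continuous_snd) continuous_const)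
  have hpP : (y, w) ∈ P := ⟨hi, (D.norm_lt_ρ0_of_lt_εc (hp.2.trans_lt hε)).trans_le (D.ρ0_le i)⟩
  -- the chart formula holds on `P ∩ Sbar ε`
  have heq : EqOn D.Λ (fun p ↦ B.inv (extChartAt (𝓡 2) (D.atlas.yc i) p.1, D.ζ B.c p.1 p.2))
      (D.Sbar ε ∩ P) := by
    rintro ⟨y', w'⟩ ⟨hp', hP'⟩
    exact D.Λ_eq_inv i hP'.1 hp'.1 hP'.2
  -- the right-hand side is continuous on `P ∩ Sbar ε`
  have hg : ContinuousOn (fun p : S × V ↦ (extChartAt (𝓡 2) (D.atlas.yc i) p.1, D.ζ B.c p.1 p.2))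
      (D.Sbar ε ∩ P) := by
    refine ContinuousOn.prodMk ?_ ?_
    · exact (continuousOn_extChartAt _).comp continuous_fst.continuousOn fun p hp ↦ hp.2.1.1
    · have hζ : ContinuousOn (fun p : S × V ↦ D.ζ B.c p.1) (D.Sbar ε ∩ P) := by
        refine (D.contMDiffOn_ζ B.c).continuousOn.comp continuous_fst.continuousOn fun p hp ↦ ?_
        have h := B.Q_symm_ne_zero hp.2.1.2
        rwa [(extChartAt (𝓡 2) (D.atlas.yc i)).left_inv hp.2.1.1] at h
      exact hζ.clm_apply continuous_snd.continuousOn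
  have hmaps : MapsTo (fun p : S × V ↦ (extChartAt (𝓡 2) (D.atlas.yc i) p.1, D.ζ B.c p.1 p.2))
      (D.Sbar ε ∩ P) B.box := by
    rintro ⟨y', w'⟩ ⟨hp', hP'⟩
    have hne : D.Q y' B.c ≠ 0 := by
      have h := B.Q_symm_ne_zero hP'.1.2
      rwa [(extChartAt (𝓡 2) (D.atlas.yc i)).left_inv hP'.1.1] at h
    exact ⟨hP'.1.2, by rw [mem_ball_zero_iff, D.norm_ζ hne hp'.1]; exact hP'.2⟩
  have hcont : ContinuousOn D.Λ (D.Sbar ε ∩ P) :=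
    ((B.contMDiffOn_inv.continuousOn.comp hg hmaps).congr heq)
  exact (hcont.continuousWithinAt ⟨hp, hpP⟩).mono_of_mem_nhdsWithin
    (inter_mem_nhdsWithin _ (hPopen.mem_nhds hpP))

/-! ### The round tubes -/

/-- **The open round tube** `T ε = {x ∈ N₃ | ρ2 x < ε}`. [folklore] -/
def T (ε : ℝ) : Set N := {x | x ∈ D.N₃ ∧ D.ρ2 x < ε}

/-- **The closed round tube** `Tbar ε = {x ∈ N₃ | ρ2 x ≤ ε}`. [folklore] -/
def Tbar (ε : ℝ) : Set N := {x | x ∈ D.N₃ ∧ D.ρ2 x ≤ ε}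

/-- Membership in `T`. [folklore] -/
theorem mem_T_iff {ε : ℝ} {x : N} : x ∈ D.T ε ↔ x ∈ D.N₃ ∧ D.ρ2 x < ε := Iff.rfl

/-- Membership in `Tbar`. [folklore] -/
theorem mem_Tbar_iff {ε : ℝ} {x : N} : x ∈ D.Tbar ε ↔ x ∈ D.N₃ ∧ D.ρ2 x ≤ ε := Iff.rfl

/-- `T ε ⊆ Tbar ε`. [folklore] -/
theorem T_subset_Tbar (ε : ℝ) : D.T ε ⊆ D.Tbar ε := fun _ hx ↦ ⟨hx.1, hx.2.le⟩

/-- `Tbar ε ⊆ T ε'` for `ε < ε'`. [folklore] -/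
theorem Tbar_subset_T {ε ε' : ℝ} (h : ε < ε') : D.Tbar ε ⊆ D.T ε' := fun _ hx ↦ ⟨hx.1, hx.2.trans_lt h⟩

/-- `T` is monotone. [folklore] -/
theorem T_mono {ε ε' : ℝ} (h : ε ≤ ε') : D.T ε ⊆ D.T ε' := fun _ hx ↦ ⟨hx.1, hx.2.trans_le h⟩

/-- `T ε ⊆ N₃`. [folklore] -/
theorem T_subset_N₃ (ε : ℝ) : D.T ε ⊆ D.N₃ := fun _ hx ↦ hx.1

/-- `Tbar ε ⊆ N₃`. [folklore] -/
theorem Tbar_subset_N₃ (ε : ℝ) : D.Tbar ε ⊆ D.N₃ := fun _ hx ↦ hx.1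

/-- **The open round tube is open.** [folklore] -/
theorem isOpen_T (ε : ℝ) : IsOpen (D.T ε) :=
  (D.continuousOn_ρ2.mono D.N₃_subset_N₁).isOpen_inter_preimage D.isOpen_N₃ isOpen_Iio

/-- The surface lies in every positive round tube. [folklore] -/
theorem b_mem_T {ε : ℝ} (hε : 0 < ε) (y : S) : D.b y ∈ D.T ε :=
  ⟨D.b_mem_N₃ y, by rw [D.ρ2_b]; exact hε⟩

/-- The surface lies in every positive round tube. [folklore] -/
theorem range_b_subset_T {ε : ℝ} (hε : 0 < ε) : range D.b ⊆ D.T ε := by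
  rintro _ ⟨y, rfl⟩; exact D.b_mem_T hε y

/-- **The closed round tube is the image of the model disc bundle**: `Tbar ε = Λ '' Sbar ε` for
`ε < εc`. [folklore] -/
theorem Tbar_eq_image {ε : ℝ} (hε : ε < D.εc) : D.Tbar ε = D.Λ '' D.Sbar ε := by
  apply le_antisymm
  · intro x hx
    refine ⟨D.Θ x, ⟨D.nrm_mem_F x, hx.2⟩, D.Λ_Θ hx.1⟩
  · rintro _ ⟨p, hp, rfl⟩
    obtain ⟨hmem, hΘ⟩ := D.Λ_spec (D.Sbar_subset_image hε hp)
    exact ⟨hmem, by rw [D.ρ2_eq_of_Θ_eq hΘ]; exact hp.2⟩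

/-- **The closed round tubes below the critical level are compact.** [folklore] -/
theorem isCompact_Tbar {ε : ℝ} (hε : ε < D.εc) : IsCompact (D.Tbar ε) := by
  rw [D.Tbar_eq_image hε]
  exact (D.isCompact_Sbar ε).image_of_continuousOn (D.continuousOn_Λ hε)

/-- The closed round tubes below the critical level are closed (`N` Hausdorff). [folklore] -/
theorem isClosed_Tbar [T2Space N] {ε : ℝ} (hε : ε < D.εc) : IsClosed (D.Tbar ε) :=
  (D.isCompact_Tbar hε).isClosed

/-- **The closed round tubes shrink to the surface**: every open set containing the surface
contains a closed round tube of positive level. [folklore] -/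
theorem exists_Tbar_subset [T2Space N] {O : Set N} (hO : IsOpen O) (hBO : range D.b ⊆ O) :
    ∃ ε : ℝ, 0 < ε ∧ ε < D.εc ∧ D.Tbar ε ⊆ O := by
  -- the compact sets `Tbar ε ∖ O`, `0 < ε ≤ εc / 2`, decrease to the empty set
  set ε₁ := D.εc / 2 with hε₁
  have hε₁pos : 0 < ε₁ := half_pos D.εc_pos
  have hε₁lt : ε₁ < D.εc := by rw [hε₁]; linarith [D.εc_pos]
  let Z : {ε : ℝ // 0 < ε ∧ ε ≤ ε₁} → Set N := fun ε ↦ D.Tbar ε.1 ∩ Oᶜ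
  have hZclosed : ∀ ε, IsClosed (Z ε) := fun ε ↦
    (D.isClosed_Tbar (ε.2.2.trans_lt hε₁lt)).inter hO.isClosed_compl
  haveI : Nonempty {ε : ℝ // 0 < ε ∧ ε ≤ ε₁} := ⟨⟨ε₁, hε₁pos, le_rfl⟩⟩
  have hdir : Directed (· ⊇ ·) Z := by
    rintro ⟨a, ha⟩ ⟨c, hc⟩
    refine ⟨⟨min a c, lt_min ha.1 hc.1, (min_le_left _ _).trans ha.2⟩, ?_, ?_⟩
    · exact inter_subset_inter_left _ fun x hx ↦ ⟨hx.1, hx.2.trans (min_le_left _ _)⟩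
    · exact inter_subset_inter_left _ fun x hx ↦ ⟨hx.1, hx.2.trans (min_le_right _ _)⟩
  have hempty : D.Tbar ε₁ ∩ ⋂ ε, Z ε = ∅ := by
    ext x
    simp only [mem_inter_iff, mem_iInter, mem_empty_iff_false, iff_false, not_and, not_forall]
    intro hx
    by_contra hall
    push Not at hall
    -- `ρ2 x ≤ ε` for all small `ε > 0`, so `ρ2 x = 0` and `x` lies on the surface, inside `O`
    have hle : ∀ ε : ℝ, 0 < ε → ε ≤ ε₁ → D.ρ2 x ≤ ε := fun ε h1 h2 ↦ (hall ⟨ε, h1, h2⟩).1.2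
    have h0 : D.ρ2 x = 0 := by
      refine le_antisymm (le_of_forall_pos_le_add fun ε hε ↦ ?_) (D.ρ2_nonneg x)
      rw [zero_add]
      exact (hle (min ε ε₁) (lt_min hε hε₁pos) (min_le_right _ _)).trans (min_le_left _ _)
    have hxB : x ∈ range D.b := (D.ρ2_eq_zero_iff (D.N₃_subset_N₂ hx.1)).1 h0
    exact (hall ⟨ε₁, hε₁pos, le_rfl⟩).2 (hBO hxB)
  obtain ⟨ε, hε⟩ := (D.isCompact_Tbar hε₁lt).elim_directed_family_closed Z hZclosed hempty hdir
  refine ⟨ε.1, ε.2.1, ε.2.2.trans_lt hε₁lt, fun x hx ↦ ?_⟩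
  by_contra hxO
  have hx' : x ∈ D.Tbar ε₁ ∩ Z ε := ⟨⟨hx.1, hx.2.trans ε.2.2⟩, hx, hxO⟩
  rw [hε] at hx'
  exact hx'

/-! ### Points at prescribed level; the punctured tube -/

/-- **Every level below the critical one is attained over every foot point.** [folklore] -/
theorem exists_ρ2_eq {t : ℝ} (h0 : 0 ≤ t) (ht : t < D.εc) (y : S) :
    ∃ x ∈ D.N₃, D.π₁ x = y ∧ D.ρ2 x = t := by
  obtain ⟨c, hc⟩ := D.exists_Q_ne_zero y
  set w : V := Real.sqrt (t / D.K y) • D.un c y with hw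
  have hwF : w ∈ D.F y := (D.F y).smul_mem _ (D.un_mem_F c y)
  have hnorm : ‖w‖ = Real.sqrt (t / D.K y) := by
    rw [hw, norm_smul, D.norm_un hc, mul_one, Real.norm_of_nonneg (Real.sqrt_nonneg _)]
  have hlevel : D.K y * ‖w‖ ^ 2 = t := by
    rw [hnorm, Real.sq_sqrt (div_nonneg h0 (D.K_pos y).le), mul_div_cancel₀ _ (D.K_pos y).ne']
  obtain ⟨x, hx, heq⟩ := D.exists_mem_N₃_Θ_eq hwF (D.norm_lt_ρ0_of_lt_εc (by rw [hlevel]; exact ht))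
  exact ⟨x, hx, congrArg Prod.fst heq, by rw [D.ρ2_eq_of_Θ_eq heq]; exact hlevel⟩

/-- **The punctured tube is the image of the punctured model disc bundle**:
`T ε ∖ b(S) = Λ '' Sstar ε` for `ε < εc`. [folklore] -/
theorem T_diff_range_eq_image {ε : ℝ} (hε : ε < D.εc) : D.T ε \ range D.b = D.Λ '' D.Sstar ε := by
  apply le_antisymm
  · rintro x ⟨hx, hxB⟩
    refine ⟨D.Θ x, ⟨D.nrm_mem_F x, ?_, hx.2⟩, D.Λ_Θ hx.1⟩
    exact (D.ρ2_pos_iff (D.N₃_subset_N₂ hx.1)).2 hxB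
  · rintro _ ⟨p, hp, rfl⟩
    obtain ⟨hmem, hΘ⟩ := D.Λ_spec (D.Sbar_subset_image hε (D.Sstar_subset_Sbar ε hp))
    have hρ : D.ρ2 (D.Λ p) = D.K p.1 * ‖p.2‖ ^ 2 := D.ρ2_eq_of_Θ_eq hΘ
    refine ⟨⟨hmem, by rw [hρ]; exact hp.2.2⟩, ?_⟩
    rw [← D.ρ2_pos_iff (D.N₃_subset_N₂ hmem), hρ]
    exact hp.2.1

omit [CompactSpace S] [Nonempty S] [T2Space S] in
/-- The punctured disc in a normal plane is preconnected (`dim F y = 2`). [folklore] -/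
theorem isPreconnected_puncturedDisc (y : S) {a : ℝ} :
    IsPreconnected {w : V | w ∈ D.F y ∧ 0 < ‖w‖ ∧ ‖w‖ < a} := by
  obtain ⟨c, hc⟩ := D.exists_Q_ne_zero y
  -- image of the punctured disc of `ℝ²` under the frame isometry
  have himage : {w : V | w ∈ D.F y ∧ 0 < ‖w‖ ∧ ‖w‖ < a} =
      D.Fr c y '' {z : E2 | 0 < ‖z‖ ∧ ‖z‖ < a} := by
    ext w
    constructor
    · rintro ⟨hw, h0, ha⟩
      refine ⟨D.ζ c y w, ?_, D.Fr_ζ hc hw⟩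
      rw [mem_setOf_eq, D.norm_ζ hc hw]
      exact ⟨h0, ha⟩
    · rintro ⟨z, ⟨h0, ha⟩, rfl⟩
      rw [mem_setOf_eq, D.norm_Fr hc]
      exact ⟨D.Fr_mem_F c y z, h0, ha⟩
  rw [himage]
  refine IsPreconnected.image ?_ _ (D.Fr c y).continuous.continuousOn
  -- the punctured disc of `ℝ²` is the image of `(0, a) × unit circle` under scaling
  have hrank : 1 < Module.rank ℝ E2 := by
    rw [← Module.finrank_eq_rank, finrank_euclideanSpace_fin]; norm_num
  have hsphere : IsPreconnected (sphere (0 : E2) 1) := isPreconnected_sphere hrank 0 1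
  have heq : {z : E2 | 0 < ‖z‖ ∧ ‖z‖ < a} = (fun p : ℝ × E2 ↦ p.1 • p.2) '' (Ioo 0 a ×ˢ sphere (0 : E2) 1) := by
    ext z
    constructor
    · rintro ⟨h0, ha⟩
      refine ⟨(‖z‖, ‖z‖⁻¹ • z), ⟨⟨h0, ha⟩, ?_⟩, ?_⟩
      · rw [mem_sphere_zero_iff_norm, norm_smul, norm_inv, norm_norm, inv_mul_cancel₀ h0.ne']
      · show ‖z‖ • ‖z‖⁻¹ • z = z
        rw [smul_smul, mul_inv_cancel₀ h0.ne', one_smul]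
    · rintro ⟨⟨r, u⟩, ⟨⟨hr0, hra⟩, hu⟩, rfl⟩
      rw [mem_sphere_zero_iff_norm] at hu
      show 0 < ‖r • u‖ ∧ ‖r • u‖ < a
      rw [norm_smul, hu, mul_one, Real.norm_of_nonneg hr0.le]
      exact ⟨hr0, hra⟩
  rw [heq]
  exact (isPreconnected_Ioo.prod hsphere).image _ (continuous_fst.smul continuous_snd).continuousOn

omit [CompactSpace S] [Nonempty S] [T2Space S] in
/-- **The punctured model disc bundle over a connected surface is preconnected.** [folklore] -/
theorem isPreconnected_Sstar [ConnectedSpace S] (ε : ℝ) : IsPreconnected (D.Sstar ε) := by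
  -- the fibres are punctured discs, hence preconnected
  have hfibre : ∀ y : S, IsPreconnected {p : S × V | p.1 = y ∧ p ∈ D.Sstar ε} := by
    intro y
    have heq : {p : S × V | p.1 = y ∧ p ∈ D.Sstar ε} =
        (fun w ↦ (y, w)) '' {w : V | w ∈ D.F y ∧ 0 < ‖w‖ ∧ ‖w‖ < Real.sqrt (ε / D.K y)} := by
      ext ⟨y', w⟩
      constructor
      · rintro ⟨hyy, hw, h0, hlt⟩
        dsimp only at hyy hw h0 hlt
        obtain rfl : y = y' := hyy.symm
        refine ⟨w, ⟨hw, ?_, ?_⟩, rfl⟩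
        · refine norm_pos_iff.2 fun h ↦ ?_
          rw [h, norm_zero, zero_pow two_ne_zero, mul_zero] at h0
          exact lt_irrefl _ h0
        · refine (Real.lt_sqrt (norm_nonneg w)).2 ?_
          rw [lt_div_iff₀ (D.K_pos y), mul_comm]
          exact hlt
      · rintro ⟨w', ⟨hw', h0, hlt⟩, h⟩
        rw [Prod.mk.injEq] at h
        obtain ⟨rfl, rfl⟩ := h
        refine ⟨rfl, hw', mul_pos (D.K_pos _) (pow_pos h0 2), ?_⟩
        have h2 : ‖w'‖ ^ 2 < ε / D.K y := (Real.lt_sqrt (norm_nonneg _)).1 hlt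
        rw [lt_div_iff₀ (D.K_pos _), mul_comm] at h2
        exact h2
    rw [heq]
    exact (D.isPreconnected_puncturedDisc y).image _ (Continuous.prodMk_right y).continuousOn
  -- trivial for `ε ≤ 0`
  by_cases hε : ε ≤ 0
  · have hemp : D.Sstar ε = ∅ := by
      ext p
      simp only [mem_Sstar_iff, mem_empty_iff_false, iff_false, not_and, not_lt]
      intro _ h0
      exact hε.trans h0.le
    rw [hemp]
    exact isPreconnected_empty
  push Not at hε
  -- nonempty fibres
  have hne : ∀ y : S, ∃ w : V, (y, w) ∈ D.Sstar ε := by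
    intro y
    obtain ⟨c, hc⟩ := D.exists_Q_ne_zero y
    refine ⟨Real.sqrt (ε / 2 / D.K y) • D.un c y, (D.F y).smul_mem _ (D.un_mem_F c y), ?_⟩
    have hlevel : D.K y * ‖Real.sqrt (ε / 2 / D.K y) • D.un c y‖ ^ 2 = ε / 2 := by
      rw [norm_smul, D.norm_un hc, mul_one, Real.norm_of_nonneg (Real.sqrt_nonneg _),
        Real.sq_sqrt (div_nonneg (half_pos hε).le (D.K_pos y).le),
        mul_div_cancel₀ _ (D.K_pos y).ne']
    show 0 < D.K y * ‖Real.sqrt (ε / 2 / D.K y) • D.un c y‖ ^ 2 ∧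
      D.K y * ‖Real.sqrt (ε / 2 / D.K y) • D.un c y‖ ^ 2 < ε
    rw [hlevel]
    exact ⟨half_pos hε, half_lt_self hε⟩
  -- the argument
  intro u v hu hv hsub ⟨⟨py, pw⟩, hp⟩ ⟨⟨qy, qw⟩, hq⟩
  by_contra hem
  rw [not_nonempty_iff_eq_empty] at hem
  -- no fibre meets both `u` and `v`
  have hdich : ∀ y : S, ∀ w w' : V, (y, w) ∈ D.Sstar ε → (y, w) ∈ u → (y, w') ∈ D.Sstar ε →
      (y, w') ∈ v → False := by
    intro y w w' hw hwu hw' hw'v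
    have hsub' : {p : S × V | p.1 = y ∧ p ∈ D.Sstar ε} ⊆ u ∪ v := fun p hp ↦ hsub hp.2
    obtain ⟨r, hr⟩ := hfibre y u v hu hv hsub' ⟨(y, w), ⟨rfl, hw⟩, hwu⟩ ⟨(y, w'), ⟨rfl, hw'⟩, hw'v⟩
    have : r ∈ D.Sstar ε ∩ (u ∩ v) := ⟨hr.1.2, hr.2⟩
    rw [hem] at this
    exact this
  -- the base sets of the fibres meeting `u`, resp. `v`, are open
  have hopen : ∀ (o : Set (S × V)), IsOpen o →
      IsOpen {y : S | ∃ w : V, (y, w) ∈ D.Sstar ε ∧ (y, w) ∈ o} := by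
    intro o ho
    refine isOpen_iff_mem_nhds.2 fun y hy ↦ ?_
    obtain ⟨w, hw, hwo⟩ := hy
    have hg : Continuous fun y' : S ↦ ((y', D.Q y' w) : S × V) :=
      continuous_id.prodMk (D.continuous_Q.clm_apply continuous_const)
    have hQw : D.Q y w = w := D.Q_apply_eq_self_iff.2 hw.1
    have h1 : ∀ᶠ y' in 𝓝 y, ((y', D.Q y' w) : S × V) ∈ o := by
      refine hg.continuousAt.preimage_mem_nhds ?_
      show o ∈ 𝓝 ((y, D.Q y w) : S × V)
      rw [hQw]
      exact ho.mem_nhds hwo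
    have hlev : Continuous fun y' : S ↦ D.K y' * ‖D.Q y' w‖ ^ 2 :=
      D.continuous_K.mul ((D.continuous_Q.clm_apply continuous_const).norm.pow 2)
    have hpos : 0 < D.K y * ‖D.Q y w‖ ^ 2 := by rw [hQw]; exact hw.2.1
    have hlt : D.K y * ‖D.Q y w‖ ^ 2 < ε := by rw [hQw]; exact hw.2.2
    have h2 : ∀ᶠ y' in 𝓝 y, 0 < D.K y' * ‖D.Q y' w‖ ^ 2 :=
      hlev.continuousAt.eventually (lt_mem_nhds hpos)
    have h3 : ∀ᶠ y' in 𝓝 y, D.K y' * ‖D.Q y' w‖ ^ 2 < ε :=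
      hlev.continuousAt.eventually (gt_mem_nhds hlt)
    show {y' : S | ∃ w : V, (y', w) ∈ D.Sstar ε ∧ (y', w) ∈ o} ∈ 𝓝 y
    filter_upwards [h1, h2, h3] with y' h1' h2' h3'
    exact ⟨D.Q y' w, ⟨D.Q_apply_mem y' w, h2', h3'⟩, h1'⟩
  set Su : Set S := {y | ∃ w : V, (y, w) ∈ D.Sstar ε ∧ (y, w) ∈ u} with hSu
  set Sv : Set S := {y | ∃ w : V, (y, w) ∈ D.Sstar ε ∧ (y, w) ∈ v} with hSv
  have hcover : (univ : Set S) ⊆ Su ∪ Sv := by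
    intro y _
    obtain ⟨w, hw⟩ := hne y
    rcases hsub hw with h | h
    · exact Or.inl ⟨w, hw, h⟩
    · exact Or.inr ⟨w, hw, h⟩
  obtain ⟨y, -, ⟨w, hw, hwu⟩, ⟨w', hw', hw'v⟩⟩ := isPreconnected_univ Su Sv (hopen u hu) (hopen v hv)
    hcover ⟨py, mem_univ _, pw, hp.1, hp.2⟩ ⟨qy, mem_univ _, qw, hq.1, hq.2⟩
  exact hdich y w w' hw hwu hw' hw'v

/-- **The punctured round tube over a connected surface is preconnected** (`ε < εc`).
[folklore] -/
theorem isPreconnected_T_diff_range [ConnectedSpace S] {ε : ℝ} (hε : ε < D.εc) :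
    IsPreconnected (D.T ε \ range D.b) := by
  rw [D.T_diff_range_eq_image hε]
  exact (D.isPreconnected_Sstar ε).image _ ((D.continuousOn_Λ hε).mono (D.Sstar_subset_Sbar ε))

end Setup

end SurfaceTube

end Literature.Geometry.Symplectic
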